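import Summits.CriticalPhenomena.SAWScalingLimit.Theorems.SAWTotalPositivityCriticalBubbleBoundJoinBigTermwise
import Summits.CriticalPhenomena.SAWScalingLimit.Theorems.SAWTotalPositivityCriticalBubbleBoundJoinEntropy

/-!
# The deterministic floor `ν' < 1/2` of the size knob of the join-mass ledger
(crux `SAWTotalPositivity.CriticalBubbleBound`, stmt-CriticalPhenomena-7117; line `docking-census-joining`,
registered floor sub-goals `bigMass_eq_blockMass_of_lt_half`, `bigMassFraction_of_lt_half` of the SIZE
knob `stub_bigMassFraction`, lead prover c8)

WHAT. For every exponent `ν' < 1/2` the size hypothesis `BigMassFraction ν'` of the entropy knob holds,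
and in fact with constant `c = 1`: for all large `i`, EVERY lex-rooted class of shifted index in the
dyadic block `B_i` is big at scale `i` (`max (height, width) ≥ 2^{ν' i}`), so `bigMass ν' i = R'_i`
termwise (`bigMass_eq_blockMass_of_lt_half`), whence `BigMassFraction ν'` (`bigMassFraction_of_lt_half`).

WHY. A class `χ ∈ lexRooted m` (`m = n - 17`, `n ∈ B_i`) is an `m`-step self-avoiding walk, so it has
`m + 1` distinct vertices (`card_verts_eq`), all inside its bounding box of `(w + 1)(h + 1)` sites
(`card_verts_le_box`). With `M = max (h, w)` this gives `(M + 1)² ≥ m + 1 = n - 16 ≥ 2^i - 16`.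
On the other hand `2^{ν' i} = 2^{i/2} · 2^{-(1/2 - ν') i} ≤ 2^{i/2} / 4` as soon as `(1/2 - ν') i ≥ 2`,
and `(X/4 + 1)² ≤ X² - 16` for `X = 2^{i/2} ≥ 8`; hence `(2^{ν' i} + 1)² ≤ 2^i - 16 ≤ (M + 1)²` and
`2^{ν' i} ≤ M` for all `i ≥ i₀(ν')`. This is the trivial ("polygons are not denser than space-filling")
floor of the size knob; every exponent `> 1/2` (non-density of critical polygons) is open, the knob
itself asks for `5/8`, and the conjectured truth is every `ν' < ν = 3/4`.

Sources: A. Hammond, Ann. Probab. 46 (2018) = arXiv:1808.09032, Definition 4.8 / Lemma 4.11 (the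
bounding-box count `(h+1)(w+1) ≥ #vertices`); N. Madras, G. Slade, *The Self-Avoiding Walk* (1993), §1.1.
-/

noncomputable section

open Literature.Probability.LatticeModels
open Literature.Probability.RandomPlanarGeometry Literature.Probability.RandomPlanarGeometry.SAW
open scoped BigOperators
open Summit.CriticalPhenomena.SAWScalingLimit.Theorems.CriticalBubbleBound.Negative (e₀)
open Summit.CriticalPhenomena.SAWScalingLimit.Theorems.CriticalBubbleBound.Docking

namespace Summit.CriticalPhenomena.SAWScalingLimit.Theorems.CriticalBubbleBound.Join

/-! ## The real threshold: `(2^{ν' i} + 1)² ≤ 2^i - 16` for `ν' < 1/2` and all large `i` -/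

/-- For `ν' < 1/2` there is `i₀` with `6 ≤ i` and `(2^{ν' i} + 1)² ≤ 2^i - 16` for all `i ≥ i₀`
(take `i₀ = N + 6` with `N ≥ 2 / (1/2 - ν')`: then `2^{(1/2 - ν') i} ≥ 4`, so `2^{ν' i} ≤ 2^{i/2} / 4`,
and `(X/4 + 1)² ≤ X² - 16` for `X = 2^{i/2} ≥ 8`). [folklore] -/
theorem exists_sq_rpow_add_one_le_of_lt_half {ν' : ℝ} (hν : ν' < 1 / 2) :
    ∃ i₀ : ℕ, ∀ i : ℕ, i₀ ≤ i → 6 ≤ i ∧ ((2 : ℝ) ^ (ν' * (i : ℝ)) + 1) ^ 2 ≤ (2 : ℝ) ^ i - 16 := by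
  set δ : ℝ := 1 / 2 - ν' with hδ
  have hδ0 : 0 < δ := by rw [hδ]; linarith
  obtain ⟨N, hN⟩ := exists_nat_ge (2 / δ)
  refine ⟨N + 6, fun i hi => ?_⟩
  have hi6 : 6 ≤ i := le_trans (Nat.le_add_left 6 N) hi
  have hiN : N ≤ i := le_trans (Nat.le_add_right N 6) hi
  refine ⟨hi6, ?_⟩
  set T : ℝ := (2 : ℝ) ^ (ν' * (i : ℝ)) with hT
  set X : ℝ := (2 : ℝ) ^ ((1 / 2 : ℝ) * (i : ℝ)) with hX
  have hT0 : 0 ≤ T := Real.rpow_nonneg (by norm_num) _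
  have hX2 : X ^ 2 = (2 : ℝ) ^ i := by
    rw [hX, ← Real.rpow_natCast ((2 : ℝ) ^ ((1 / 2 : ℝ) * (i : ℝ))) 2,
      ← Real.rpow_mul (by norm_num : (0 : ℝ) ≤ 2)]
    have : (1 / 2 : ℝ) * (i : ℝ) * ((2 : ℕ) : ℝ) = ((i : ℕ) : ℝ) := by push_cast; ring
    rw [this, Real.rpow_natCast]
  -- `X ≥ 8`
  have hpow : (64 : ℝ) ≤ (2 : ℝ) ^ i := by
    have : (2 : ℝ) ^ 6 ≤ (2 : ℝ) ^ i := pow_le_pow_right₀ (by norm_num) hi6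
    norm_num at this
    exact this
  have hX0 : 0 ≤ X := Real.rpow_nonneg (by norm_num) _
  have hX8 : 8 ≤ X := by nlinarith
  -- `2^{δ i} ≥ 4`
  have hδi : (2 : ℝ) ≤ δ * (i : ℝ) := by
    have hNi : (N : ℝ) ≤ (i : ℝ) := Nat.cast_le.2 hiN
    have h2 : 2 / δ ≤ (i : ℝ) := le_trans hN hNi
    rw [div_le_iff₀ hδ0] at h2
    linarith
  have hD : (4 : ℝ) ≤ (2 : ℝ) ^ (δ * (i : ℝ)) := by
    have h := Real.rpow_le_rpow_of_exponent_le (by norm_num : (1 : ℝ) ≤ 2) hδi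
    have h4 : (2 : ℝ) ^ (2 : ℝ) = 4 := by rw [Real.rpow_two]; norm_num
    rw [h4] at h
    exact h
  -- `T · 2^{δ i} = X`, so `4 T ≤ X`
  have hTX : T * (2 : ℝ) ^ (δ * (i : ℝ)) = X := by
    rw [hT, hX, ← Real.rpow_add (by norm_num : (0 : ℝ) < 2)]
    congr 1
    rw [hδ]; ring
  have hT4 : 4 * T ≤ X := by
    calc 4 * T = T * 4 := mul_comm _ _
      _ ≤ T * (2 : ℝ) ^ (δ * (i : ℝ)) := mul_le_mul_of_nonneg_left hD hT0
      _ = X := hTX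
  rw [← hX2]
  nlinarith

/-! ## Every class of block `i` is big at scale `i` beyond the threshold -/

/-- The bounding-box floor: if `2^i ≤ n` and `(2^{ν' i} + 1)² ≤ 2^i - 16`, then every lex-rooted class
of walk length `n - 17` is big at exponent `ν'` and scale `i` — its `n - 16` distinct vertices fit in
the `(w+1)(h+1) ≤ (M+1)²` sites of its bounding box, `M = max (h, w)`, so `(2^{ν' i} + 1)² ≤ (M+1)²`.
[cite: Hammond2015SAPJoining, Lemma 4.11] -/
theorem isBigAt_of_sq_rpow_add_one_le {ν' : ℝ} {i n : ℕ} (hi6 : 6 ≤ i) (hn : 2 ^ i ≤ n)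
    (hth : ((2 : ℝ) ^ (ν' * (i : ℝ)) + 1) ^ 2 ≤ (2 : ℝ) ^ i - 16)
    {χ : ℕ → Site 2} (hχ : χ ∈ lexRooted (n - joinShift)) : IsBigAt ν' i (n - joinShift) χ := by
  unfold IsBigAt
  have hbox := card_verts_le_box (n - joinShift) χ
  rw [card_verts_eq (lexRooted_subset (n - joinShift) hχ)] at hbox
  have hw : 0 ≤ width (n - joinShift) χ := by
    have := xmin_le_apply χ (Nat.zero_le (n - joinShift))
    have := apply_le_xmax χ (Nat.zero_le (n - joinShift))
    simp only [width]; omega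
  have hh : 0 ≤ height (n - joinShift) χ := by
    have := ymin_le_apply χ (Nat.zero_le (n - joinShift))
    have := apply_le_ymax χ (Nat.zero_le (n - joinShift))
    simp only [height]; omega
  set M : ℤ := max (height (n - joinShift) χ) (width (n - joinShift) χ) with hM
  have hMh : height (n - joinShift) χ ≤ M := le_max_left _ _
  have hMw : width (n - joinShift) χ ≤ M := le_max_right _ _
  have hM0 : 0 ≤ M := le_trans hh hMh
  have hsq : (((n - joinShift : ℕ) : ℤ) + 1) ≤ (M + 1) * (M + 1) := by
    push_cast at hbox
    nlinarith
  have hn17 : 17 ≤ n := le_trans (by norm_num) (le_trans (pow_le_pow_right₀ (by norm_num) hi6) hn)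
  have hcast : ((n - joinShift : ℕ) : ℝ) = (n : ℝ) - 17 := by
    have : ((n - joinShift : ℕ) : ℤ) = (n : ℤ) - 17 := by simp only [joinShift]; omega
    have h' : (((n - joinShift : ℕ) : ℤ) : ℝ) = (((n : ℤ) - 17 : ℤ) : ℝ) := by rw [this]
    push_cast at h'
    exact h'
  have hnR : (2 : ℝ) ^ i ≤ n := by exact_mod_cast hn
  have hsqR : (n : ℝ) - 16 ≤ ((M : ℝ) + 1) * ((M : ℝ) + 1) := by
    have h' : ((n - joinShift : ℕ) : ℝ) + 1 ≤ ((M : ℝ) + 1) * ((M : ℝ) + 1) := by exact_mod_cast hsq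
    rw [hcast] at h'; linarith
  have hM0R : (0 : ℝ) ≤ (M : ℝ) := by exact_mod_cast hM0
  set T : ℝ := (2 : ℝ) ^ (ν' * (i : ℝ)) with hT
  have hT0 : 0 ≤ T := Real.rpow_nonneg (by norm_num) _
  have h1 : (T + 1) ^ 2 ≤ ((M : ℝ) + 1) ^ 2 := by nlinarith
  have h2 : T + 1 ≤ (M : ℝ) + 1 := le_of_pow_le_pow_left₀ two_ne_zero (by linarith) h1
  linarith

/-! ## The registered floor sub-goals -/

/-- **Deterministic size floor, equality form** (registered sub-goal `bigMass_eq_blockMass_of_lt_half`):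
for `ν' < 1/2` and all large `i`, every class of block `i` is big at scale `i`, so the big mass IS the
block mass, `bigMass ν' i = R'_i` (termwise, the filter is everything). [cite: Hammond2015SAPJoining, Lemma 4.12] -/
theorem bigMass_eq_blockMass_of_lt_half : ∀ ν' : ℝ, ν' < 1 / 2 → ∃ i₀ : ℕ, ∀ i : ℕ, i₀ ≤ i → bigMass ν' i = blockMass jterm i := by
  intro ν' hν
  obtain ⟨i₀, hi₀⟩ := exists_sq_rpow_add_one_le_of_lt_half hν
  refine ⟨i₀, fun i hi => ?_⟩
  obtain ⟨hi6, hth⟩ := hi₀ i hi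
  classical
  rw [blockMass, bigMass]
  refine Finset.sum_congr rfl fun n hn => ?_
  have hn2 : 2 ^ i ≤ n := (Finset.mem_Ico.1 hn).1
  split_ifs with h
  · rw [jterm_of_le h, cterm]
    have : (lexRooted (n - joinShift)).filter (fun χ => IsBigAt ν' i (n - joinShift) χ) =
        lexRooted (n - joinShift) :=
      Finset.filter_true_of_mem fun χ hχ => isBigAt_of_sq_rpow_add_one_le hi6 hn2 hth hχ
    rw [this]
  · rw [jterm_of_lt (not_le.1 h)]

/-- **Deterministic size floor** (registered sub-goal `bigMassFraction_of_lt_half`): `BigMassFraction ν'`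
for every `ν' < 1/2`, with `c = 1` (from `bigMass_eq_blockMass_of_lt_half`). The knob of the line asks
for `ν' = 5/8 > 1/2`, which this floor does not reach. [cite: MadrasSlade1993, §1.1] -/
theorem bigMassFraction_of_lt_half : ∀ ν' : ℝ, ν' < 1 / 2 → BigMassFraction ν' := by
  intro ν' hν
  obtain ⟨i₀, h⟩ := bigMass_eq_blockMass_of_lt_half ν' hν
  exact ⟨1, one_pos, i₀, fun i hi => by rw [one_mul, h i hi]⟩

end Summit.CriticalPhenomena.SAWScalingLimit.Theorems.CriticalBubbleBound.Join

end
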